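import Literature.AnabelianGeometry.AbsoluteAnabelian.AbsTopIII.ReconstructionCor110iiPrime
import Literature.AnabelianGeometry.AbsoluteAnabelian.LocalTateModuleH2
import Literature.AnabelianGeometry.AbsoluteAnabelian.GaloisCyclotomeRestriction
import HarnessLib

/-!
# [AbsTopIII] Cor. 1.10 (i)(a) — `H²(G_k, μ_Ẑ(G_k)) ⥲ Ẑ` as a NATURAL isomorphism (statements)

Mochizuki, *Topics in Absolute Anabelian Geometry III*, Cor. 1.10 (i)(a) pp. 41–42 (manuscript pagination, lit
key `paper:url-5493eb38cbb7`): «one constructs the natural isomorphism `H²(G_k, μ_Ẑ(G_k)) ⥲ Ẑ`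
"group-theoretically" from `G_k` via the algorithm described in the proof of [Mzk9], Proposition 1.2.1, (vii)»;
p. 42 after (b): «the asserted "functoriality" is with respect to arbitrary injective open homomorphisms of
profinite groups»; Rmk. 1.10.1 (iii) p. 44: for open injections this functoriality «is to be understood in the
sense of a compatibility relative to dividing … by a factor given by the index».

WHY THIS FILE (abc-iut layer L4, row «COR110ia-NAT», L4-lead RULING #7k; abc-iut-L4-d1).  abc-iut-L4-t1 typed
(i)(a) as `AbsTopIII.Cor_1_10_i_a` (`CyclotomicSynchronization.lean`): `Nonempty (H²(G_k, μ_Ẑ(G_k)) ≃+ Ẑ)` for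
each MLF separately — PROVED (abc-iut-L4-t17, `cor_1_10_i_a_holds`), but a per-field `Nonempty` does not carry
«natural»/«functorial».  The bi-anabelian content is typed here, over the REAL objects: abc-iut-L4-t1's
group-theoretic cyclotome `μ_Ẑ(G)` and its continuous cohomology `galCyclotomeH2`, the transport
`galCyclotomeCohomologyMap α 2 = H²(α; μ_Ẑ(α))` along an ARBITRARY isomorphism of topological groups
(`ReconstructionCor110iiPrime.lean`), abc-iut-w5-d201's restriction `galCyclotomeRes k k′ 2` along a finite
extension (`GaloisCyclotomeRestriction.lean`), and Mathlib's `Ẑ` = the profinite completion of `ℤ`: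

* `AbsTopIII.Cor_1_10_i_a_natural` — ONE family `r_k : H²(G_k, μ_Ẑ(G_k)) ≃+ Ẑ` over the MLFs `k : Type`
  (valued form) such that (1) `r_k` IS the residue («invariant») map of local class field theory: for some
  `G_k`-equivariant `φ : μ_{ℚ/ℤ}(G_k) ≅ μ(k̄)` ([AbsAnab] Prop. 1.2.1 (vi)), at every finite level `n` the
  `ℤ/n`-component of `r_k x` is THE invariant map `inv_n` (`invMap`, characterised by `Prop121vii.IsInvariantMap`
  — Serre XIV §1: bijective with `inv(κ_n(π) ∪ χ) = 1`; unique) of the image of `x` in `H²(G_k, μ_n(k̄))` —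
  this PINS `r_k`; and (2) INVARIANCE: `r_{k₂} ∘ H²(α; μ_Ẑ(α)) = r_{k₁}` for EVERY isomorphism of topological
  groups `α : G_{k₁} ≃ₜ* G_{k₂}`, geometric or not ([AbsAnab] Prop. 1.2.1 (vii) «`α` preserves the residue map»
  in the `Ẑ`-limit; `Ẑ` carries no `α`);
* `AbsTopIII.Cor_1_10_i_a_resNatural` — the same family with, in addition, (3) the INDEX FORMULA of Rmk. 1.10.1
  (iii) for the open injections `G_{k′} ↪ G_k` of finite extensions: `r_{k′} ∘ Res = [k′ : k] · r_k`.

Neither is closable by choice: (1) determines every `r_k`; (2) and (3) are then theorems about THE residue map.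
Statements only (`Prop`s; no new data definitions); the closers are proof-only companions
(`cor_1_10_i_a_natural_holds` over abc-iut-L4-d3's `Cor110Nat.residueZHat_transport`; the index clause over
abc-iut-w5-d201's `invLevel_toLimitClasses_galCyclotomeRes` + the restriction compatibility of the canonical
cyclotome identifications, abc-iut-L4-t11's (S4)).  HONEST FRAMING: [AbsTopIII]/[AbsAnab] are refereed papers;
classical local class field theory; nothing here bears on [IUTchIII] Cor. 3.12 or takes a side; typed ≠ proved.
-/

noncomputable section

open CategoryTheory Function
open Field ValuativeRel
open ProfiniteGrp ProfiniteGrp.ProfiniteCompletion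

namespace Literature.AnabelianGeometry.AbsoluteAnabelian

open _root_.TopRep _root_.ContRepresentation _root_.ContinuousCohomology
open Literature.NumberTheory.GaloisRepresentations
open Literature.NumberTheory.GaloisRepresentations.DiscreteGaloisModule
open Literature.AnabelianGeometry.EtaleTheta Literature.AnabelianGeometry.EtaleTheta.ZHatLevel

namespace AbsTopIII

/-- **[AbsTopIII] Cor. 1.10 (i)(a), NATURAL form.**  «One constructs the natural isomorphism
`H²(G_k, μ_Ẑ(G_k)) ⥲ Ẑ` "group-theoretically" from `G_k`» (p. 42): there is ONE family of additive isomorphisms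
`r_k : H²(G_k, μ_Ẑ(G_k)) ≃+ Ẑ` (`Ẑ` = the profinite completion of `ℤ`), indexed by the MLFs `k : Type` (valued
form), such that
(1) `r_k` IS the residue map of local class field theory — for some `G_k`-equivariant
`φ : μ_{ℚ/ℤ}(G_k) ≅ μ(k̄)`, for every `x` and every level `n ≥ 1`, the `ℤ/n`-component of `r_k x` is THE invariant
map `inv_n` (`invMap k n`, unique by `Prop121vii.existsUniqueInvariantMap_holds`) of the image of `x` in
`H²(G_k, μ_n(k̄))` (through `H²(φ)`, abc-iut-L4-t11's `galCyclotomeIsoTateModule`, and the projection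
`Ẑ(1) → μ_n`); and
(2) for EVERY isomorphism of topological groups `α : G_{k₁} ≃ₜ* G_{k₂}`:
`r_{k₂} (H²(α; μ_Ẑ(α)) x) = r_{k₁} x` — the residue is an invariant of the profinite group.
Universe `0`. [cite: MochizukiAbsTopIII2015, Cor 1.10 (i) p.42] -/
def Cor_1_10_i_a_natural : Prop :=
  ∃ r : ∀ (k : Type) [Field k] [ValuativeRel k] [TopologicalSpace k] [IsNonarchimedeanLocalField k]
      [CharZero k], galCyclotomeH2 (absoluteGaloisGroup k) ≃+ Additive (completion (GrpCat.of (Multiplicative ℤ))),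
    (∀ (k : Type) [Field k] [ValuativeRel k] [TopologicalSpace k] [IsNonarchimedeanLocalField k]
      [CharZero k],
      ∃ (φ : muQZ (absoluteGaloisGroup k) ≃+ Additive (CommGroup.torsion (AlgebraicClosure k)ˣ))
        (hφ : ∀ (σ : absoluteGaloisGroup k) (x : muQZ (absoluteGaloisGroup k)),
          (((Additive.toMul (φ (σ • x)) : CommGroup.torsion (AlgebraicClosure k)ˣ) :
              (AlgebraicClosure k)ˣ) : AlgebraicClosure k) =
            σ • (((Additive.toMul (φ x) : CommGroup.torsion (AlgebraicClosure k)ˣ) :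
              (AlgebraicClosure k)ˣ) : AlgebraicClosure k)),
        ∀ (x : galCyclotomeH2 (absoluteGaloisGroup k)) (n : ℕ+),
          Multiplicative.toAdd (level n (Additive.toMul (r k x))) =
            invMap k n (cohomologyMap ((muSystem k).projHom n) 2
              ((cohomologyMap (galCyclotomeIsoTateModule k φ hφ).hom 2).hom x))) ∧
    ∀ (k₁ : Type) [Field k₁] [ValuativeRel k₁] [TopologicalSpace k₁] [IsNonarchimedeanLocalField k₁]
      [CharZero k₁]
      (k₂ : Type) [Field k₂] [ValuativeRel k₂] [TopologicalSpace k₂] [IsNonarchimedeanLocalField k₂]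
      [CharZero k₂]
      (α : absoluteGaloisGroup k₁ ≃ₜ* absoluteGaloisGroup k₂) (x : galCyclotomeH2 (absoluteGaloisGroup k₁)),
      r k₂ (galCyclotomeCohomologyMap α 2 x) = r k₁ x

/-- **[AbsTopIII] Cor. 1.10 (i)(a) with Rmk. 1.10.1 (iii): natural in arbitrary injective OPEN homomorphisms
«up to the index».**  The family of (1)+(2) above satisfies moreover (3): for every finite extension `k′/k` of
MLFs (the open injection `G_{k′} ↪ G_k`; `Res = galCyclotomeRes k k′ 2`, abc-iut-w5-d201, the restriction on
the cohomology of the group-theoretic cyclotomes) and every `x ∈ H²(G_k, μ_Ẑ(G_k))`,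
`r_{k′} (Res x) = [k′ : k] · r_k x` — «a compatibility relative to dividing the `Ẑ` … by a factor given by the
index of the image of the induced open homomorphism» (Rmk. 1.10.1 (iii) p. 44).  Universe `0`.
[cite: MochizukiAbsTopIII2015, Remark 1.10.1 p.44] -/
def Cor_1_10_i_a_resNatural : Prop :=
  ∃ r : ∀ (k : Type) [Field k] [ValuativeRel k] [TopologicalSpace k] [IsNonarchimedeanLocalField k]
      [CharZero k], galCyclotomeH2 (absoluteGaloisGroup k) ≃+ Additive (completion (GrpCat.of (Multiplicative ℤ))),
    (∀ (k : Type) [Field k] [ValuativeRel k] [TopologicalSpace k] [IsNonarchimedeanLocalField k]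
      [CharZero k],
      ∃ (φ : muQZ (absoluteGaloisGroup k) ≃+ Additive (CommGroup.torsion (AlgebraicClosure k)ˣ))
        (hφ : ∀ (σ : absoluteGaloisGroup k) (x : muQZ (absoluteGaloisGroup k)),
          (((Additive.toMul (φ (σ • x)) : CommGroup.torsion (AlgebraicClosure k)ˣ) :
              (AlgebraicClosure k)ˣ) : AlgebraicClosure k) =
            σ • (((Additive.toMul (φ x) : CommGroup.torsion (AlgebraicClosure k)ˣ) :
              (AlgebraicClosure k)ˣ) : AlgebraicClosure k)),
        ∀ (x : galCyclotomeH2 (absoluteGaloisGroup k)) (n : ℕ+),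
          Multiplicative.toAdd (level n (Additive.toMul (r k x))) =
            invMap k n (cohomologyMap ((muSystem k).projHom n) 2
              ((cohomologyMap (galCyclotomeIsoTateModule k φ hφ).hom 2).hom x))) ∧
    (∀ (k₁ : Type) [Field k₁] [ValuativeRel k₁] [TopologicalSpace k₁] [IsNonarchimedeanLocalField k₁]
      [CharZero k₁]
      (k₂ : Type) [Field k₂] [ValuativeRel k₂] [TopologicalSpace k₂] [IsNonarchimedeanLocalField k₂]
      [CharZero k₂]
      (α : absoluteGaloisGroup k₁ ≃ₜ* absoluteGaloisGroup k₂) (x : galCyclotomeH2 (absoluteGaloisGroup k₁)),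
      r k₂ (galCyclotomeCohomologyMap α 2 x) = r k₁ x) ∧
    ∀ (k : Type) [Field k] [ValuativeRel k] [TopologicalSpace k] [IsNonarchimedeanLocalField k] [CharZero k]
      (k' : Type) [Field k'] [ValuativeRel k'] [TopologicalSpace k'] [IsNonarchimedeanLocalField k'] [CharZero k']
      [Algebra k k'] [FiniteDimensional k k'] (x : galCyclotomeH2 (absoluteGaloisGroup k)),
      r k' ((galCyclotomeRes k k' 2).hom x) = (Module.finrank k k') • r k x

end AbsTopIII

end Literature.AnabelianGeometry.AbsoluteAnabelian
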